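import Summits.RiemannHypothesis.RiemannHypothesis.Theorems.SuzukiWindowsDoorExplicitWindowPolarWindows

/-!
# SuzukiWindowsDoorExplicitWindowPolarUniversal — a clean window `t ≤ (θ−1)/28` for EVERY `θ ≥ 4`, from the polar envelope (column DBR; RH-FREE)

RH-FREE; nothing here bears on the truth of RH (a clean window certifies nothing about RH; each is a finite instance
of the `∀ t`-clause of the RH-EQUIVALENT residual `AllWindowsWitness`, never evidence for it).  The universal
window of `SuzukiWindowsDoorExplicitWindow` (`t ≤ (θ−1)/36`, `θ ≥ 2`, pure-power envelope) improved by the polar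
envelope of `SuzukiWindowsDoorExplicitWindowPolar[Windows]`: with `T = (θ−1)/28`, `σ₀ = 14`, `θ_e = 29θ/49`, the
test quantity is `π²(2/θ_e) e^{4ε(14) − 20/49} q^{θ−1}/λ²` with `q = (πe/7)² e^{4ε(14) − 1/14 − 20/49} < 0.94` and
`λ = (149θ − 189)/(7(θ−1)) ≥ 19`.  ([Su20] Thm 1.2 (K-v) with the explicit `τ(θ) = (θ−1)/28`, `θ ≥ 4`.)
-/

noncomputable section

-- D-0017: `Summit.<S>.<S>.…` is the designed namespace of a single-problem summit.
set_option linter.dupNamespace false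

open MeasureTheory Set Filter Topology Complex

namespace Summit.RiemannHypothesis.RiemannHypothesis.Theorems.SuzukiWindowsDoorExplicitWindowPolarUniversal

open Literature.NumberTheory.LFunctions
open Summit.RiemannHypothesis.RiemannHypothesis.Theorems.SuzukiWindowsDoorExplicitWindowPolarWindows

/-- `ε(14) ≤ 1/560` (`π > 3`, `π < 3.1416`, `2^{3−14} = 2^{−11}`). -/
theorem eps_fourteen_le :
    1 / (6 * (14 : ℝ) ^ 2) + 1 / (Real.pi * (14 : ℝ) ^ 3) + Real.pi ^ 2 / 6 * (2 : ℝ) ^ ((3 : ℝ) - 14)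
      ≤ 1 / 560 := by
  have hπ3 := Real.pi_gt_three
  have hπ := Real.pi_lt_d4
  have h1 : 1 / (Real.pi * (14 : ℝ) ^ 3) ≤ 1 / (3 * (14 : ℝ) ^ 3) := by gcongr
  have h2 : (2 : ℝ) ^ ((3 : ℝ) - 14) = 1 / 2 ^ 11 := by
    rw [show (3 : ℝ) - 14 = -((11 : ℕ) : ℝ) by norm_num, Real.rpow_neg (by norm_num), Real.rpow_natCast,
      one_div]
  have h3 : Real.pi ^ 2 ≤ (3.1416 : ℝ) ^ 2 := by gcongr
  have h4 : Real.pi ^ 2 / 6 * (2 : ℝ) ^ ((3 : ℝ) - 14) ≤ (3.1416 : ℝ) ^ 2 / 6 * (1 / 2 ^ 11) := by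
    rw [h2]; gcongr
  have h5 : 1 / (3 * (14 : ℝ) ^ 3) + (3.1416 : ℝ) ^ 2 / 6 * (1 / 2 ^ 11) + 1 / (6 * (14 : ℝ) ^ 2)
      ≤ 1 / 560 := by norm_num
  linarith

/-- **A UNIT-EIGENVALUE-FREE WINDOW `t ≤ (θ−1)/28` FOR EVERY `θ ≥ 4`** (RH-free; [Su20] Thm 1.2 (K-v) with an explicit
`τ` linear in `θ`, rate `1/28` vs `1/36` of the pure-power envelope): `±1` is not an eigenvalue of `𝖪_θ[t]` on
`L²(−t,t)`.  A clean window certifies nothing about RH. -/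
theorem noUnitEigenvalue_limKernel_of_le_polar {θ t : ℝ} (hθ : 4 ≤ θ) (ht : t ≤ (θ - 1) / 28) :
    NoUnitEigenvalue (limKernel θ) t := by
  have hθ1 : 0 < θ - 1 := by linarith
  have hθne : θ - 1 ≠ 0 := ne_of_gt hθ1
  have hθ0 : 0 < θ := by linarith
  set T : ℝ := (θ - 1) / 28 with hT
  have hT0 : 0 < T := by rw [hT]; positivity
  have hp := Real.pi_lt_d4.le
  have he := Real.exp_one_lt_d9.le
  -- the data of `noUnitEigenvalue_limKernel_polar` at `σ₀ = 14`, `θ_e = 29θ/49`, `T = (θ−1)/28`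
  have hX : 2 * T = (θ - 1) / 14 := by rw [hT]; ring
  have ha : 3 * θ * (2 * T) / (θ - 1) - 2 * θ * (2 * T) ^ 2 / (θ - 1) ^ 2 = 10 * θ / 49 := by
    rw [hX]; field_simp; ring
  have hl : (2 * θ - 2) / (2 * T) - (1 + 6 * θ / (θ - 1) - 4 * θ * (2 * T) / (θ - 1) ^ 2)
      = (149 * θ - 189) / (7 * (θ - 1)) := by
    rw [hX]; field_simp; ring
  have hl19 : 19 ≤ (149 * θ - 189) / (7 * (θ - 1)) := by
    rw [le_div_iff₀ (by positivity)]; linarith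
  have hcX : (1 + 6 * θ / (θ - 1) - 4 * θ * (2 * T) / (θ - 1) ^ 2) * (2 * T) = (θ - 1) / 14 + 20 * θ / 49 := by
    rw [hX]; field_simp; ring
  refine noUnitEigenvalue_limKernel_polar (θ := θ) (θe := 29 * θ / 49) (σ₀ := 14) (T := T) (by norm_num) hT0
    (by rw [hT]; linarith) (by linarith) (by rw [ha]; linarith) (by rw [hl]; linarith) ?_ ht
  rw [hl, hcX]
  set ε : ℝ := 1 / (6 * (14 : ℝ) ^ 2) + 1 / (Real.pi * (14 : ℝ) ^ 3)
    + Real.pi ^ 2 / 6 * (2 : ℝ) ^ ((3 : ℝ) - 14) with hε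
  have hε0 : 0 ≤ ε := by positivity
  have hε1 : ε ≤ 1 / 560 := eps_fourteen_le
  set l : ℝ := (149 * θ - 189) / (7 * (θ - 1)) with hldef
  have hl0 : 0 < l := by linarith
  set X : ℝ := 2 * T with hXdef
  have hX0 : 0 < X := by positivity
  -- abbreviations for the four factors of `A`
  set S : ℝ := Real.sqrt (2 / (29 * θ / 49)) with hS
  have hS1 : S ≤ 1 := Real.sqrt_le_one.mpr (by rw [div_le_one (by positivity)]; linarith)
  have hS0 : 0 ≤ S := Real.sqrt_nonneg _
  -- the geometric base `q = (πe/7)² e^{4ε − 1/14 − 20/49} ≤ 1`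
  set r : ℝ := 4 * ε - 1 / 14 - 20 / 49 with hr
  have hq1 : (Real.pi * Real.exp 1 / 7) ^ 2 * Real.exp r ≤ 1 := by
    have h1 : (Real.pi * Real.exp 1 / 7) ^ 2 ≤ (3.1416 * 2.7182818286 / 7) ^ 2 := by gcongr
    have hy : 0 ≤ 1 / 14 + 20 / 49 - 4 * ε := by linarith
    have h2 : Real.exp r ≤ 1 / (1 + (1 / 14 + 20 / 49 - 1 / 140) + (1 / 14 + 20 / 49 - 1 / 140) ^ 2 / 2) := by
      have hq := Real.quadratic_le_exp_of_nonneg hy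
      have hpos : 0 < 1 + (1 / 14 + 20 / 49 - 4 * ε) + (1 / 14 + 20 / 49 - 4 * ε) ^ 2 / 2 := by positivity
      rw [show r = -(1 / 14 + 20 / 49 - 4 * ε) by rw [hr]; ring, Real.exp_neg]
      calc (Real.exp (1 / 14 + 20 / 49 - 4 * ε))⁻¹ ≤ (1 + (1 / 14 + 20 / 49 - 4 * ε)
            + (1 / 14 + 20 / 49 - 4 * ε) ^ 2 / 2)⁻¹ := inv_anti₀ hpos hq
        _ ≤ _ := by
            rw [← one_div]
            apply one_div_le_one_div_of_le (by norm_num)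
            nlinarith
    calc (Real.pi * Real.exp 1 / 7) ^ 2 * Real.exp r
        ≤ (3.1416 * 2.7182818286 / 7) ^ 2
          * (1 / (1 + (1 / 14 + 20 / 49 - 1 / 140) + (1 / 14 + 20 / 49 - 1 / 140) ^ 2 / 2)) := by
          gcongr
      _ ≤ 1 := by norm_num
  have hq0 : 0 ≤ (Real.pi * Real.exp 1 / 7) ^ 2 * Real.exp r := by positivity
  -- algebra on the line: `(2π)^{θ−1} (e/(θ−1))^{θ−1} X^{θ−1} = (πe/7)^{θ−1}`
  have hprod : (2 * Real.pi) ^ (θ - 1) * (Real.exp 1 / (θ - 1)) ^ (θ - 1) * X ^ (θ - 1)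
      = (Real.pi * Real.exp 1 / 7) ^ (θ - 1) := by
    have h2π : (0 : ℝ) ≤ 2 * Real.pi := by positivity
    have hQ : (0 : ℝ) ≤ Real.exp 1 / (θ - 1) := by positivity
    rw [← Real.mul_rpow h2π hQ, ← Real.mul_rpow (mul_nonneg h2π hQ) hX0.le]
    congr 1
    rw [hX]; field_simp; ring
  have hXpow : X ^ (2 * θ - 2) = (X ^ (θ - 1)) ^ 2 := by
    rw [show (2 : ℝ) * θ - 2 = (θ - 1) * 2 by ring, Real.rpow_mul hX0.le, Real.rpow_two]
  have hE : Real.exp (2 * θ * ε) ^ 2 * Real.exp (-((θ - 1) / 14 + 20 * θ / 49))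
      = Real.exp r ^ (θ - 1) * Real.exp (4 * ε - 20 / 49) := by
    rw [← Real.exp_mul, sq, ← Real.exp_add, ← Real.exp_add, ← Real.exp_add]
    congr 1; rw [hr]; ring
  have hpow2 : ((Real.pi * Real.exp 1 / 7) ^ (θ - 1)) ^ 2 = ((Real.pi * Real.exp 1 / 7) ^ 2) ^ (θ - 1) := by
    rw [← Real.rpow_two, ← Real.rpow_mul (by positivity), ← Real.rpow_two,
      ← Real.rpow_mul (by positivity)]
    congr 1; ring
  have hgeom : ((Real.pi * Real.exp 1 / 7) ^ 2) ^ (θ - 1) * Real.exp r ^ (θ - 1) ≤ 1 := by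
    rw [← Real.mul_rpow (by positivity) (Real.exp_pos r).le]
    exact Real.rpow_le_one hq0 hq1 hθ1.le
  have her0 : Real.exp (4 * ε - 20 / 49) ≤ 1 := Real.exp_le_one_iff.mpr (by linarith)
  -- the test quantity is at most `π²`
  have key : ((2 * Real.pi) ^ (θ - 1) * (Real.pi * S) * (Real.exp 1 / (θ - 1)) ^ (θ - 1)
      * Real.exp (2 * θ * ε)) ^ 2 * (X ^ (2 * θ - 2) * Real.exp (-((θ - 1) / 14 + 20 * θ / 49)))
      ≤ Real.pi ^ 2 := by
    calc ((2 * Real.pi) ^ (θ - 1) * (Real.pi * S) * (Real.exp 1 / (θ - 1)) ^ (θ - 1)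
          * Real.exp (2 * θ * ε)) ^ 2 * (X ^ (2 * θ - 2) * Real.exp (-((θ - 1) / 14 + 20 * θ / 49)))
        = Real.pi ^ 2 * S ^ 2 * ((2 * Real.pi) ^ (θ - 1) * (Real.exp 1 / (θ - 1)) ^ (θ - 1) * X ^ (θ - 1)) ^ 2
          * (Real.exp (2 * θ * ε) ^ 2 * Real.exp (-((θ - 1) / 14 + 20 * θ / 49))) := by
          rw [hXpow]; ring
      _ = Real.pi ^ 2 * S ^ 2 * ((((Real.pi * Real.exp 1 / 7) ^ 2) ^ (θ - 1) * Real.exp r ^ (θ - 1))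
          * Real.exp (4 * ε - 20 / 49)) := by
          rw [hprod, hE, hpow2]; ring
      _ ≤ Real.pi ^ 2 * 1 ^ 2 * (1 * 1) := by gcongr
      _ = Real.pi ^ 2 := by ring
  rw [div_lt_one (by positivity)]
  calc _ ≤ Real.pi ^ 2 := key
    _ ≤ 3.1416 ^ 2 := by gcongr
    _ < 19 ^ 2 := by norm_num
    _ ≤ l ^ 2 := by gcongr

end Summit.RiemannHypothesis.RiemannHypothesis.Theorems.SuzukiWindowsDoorExplicitWindowPolarUniversal

end
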